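import Summits.Ventures.Crystal3D.Theorems.StickyWulffConstantCoaxialWallLawInPlaneCount
import Summits.Ventures.Crystal3D.Theorems.StickyWulffConstantCoaxialWallLawInPlaneSix
import Summits.Ventures.Crystal3D.Theorems.StickyWulffConstantGenericWallFloorGrainCredits
import HarnessLib

/-!
# The riser count with CLIMBING vacancies only (outer-face bookkeeping of the rigid rung)

HONEST FRAMING. Part of the venture `Summits/Ventures/Crystal3D` (cell `crystal3d-full`), helper
`--supports` the crux `CoaxialWallLaw` (stmt-Ventures-19481, `route-Ventures-StickyWulffConstant`),
REGISTERED line `WallLedgerF` (planner cf-p1 gen 16), stub `stub_coaxialTwoSlabAdhesion`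
(terrace/riser slot ledger, RIGID rung).  Rung credit only.

The riser count `inPlane_vacancies_ge_sine` (`…CoaxialWallLawInPlaneCount`) bounds from below the
number of ALL vacant in-plane slots of the bottom grain.  For the stub the two OUTER faces of the
cell must be booked as well, and an in-plane slot of a tilted frame may point down and out of the
cell through the bottom face.  This file records that the riser count only ever uses CLIMBING
vacancies (`x + A w ∉ X` with `(x + A w)₂ > x₂`): a climbing slot of a bottom-slab ball never
leaves the cell through the floor, so the wall credit and the outer-face credit (descending vacant
slots of the bottom sample, `outerCredits_ge`) sit on DISJOINT slots.

* `forced_upSlots_cell_abs` — one in-plane class `±A W`: `√2 |⟪A W, e₃⟫| πρ² − √2π(6R₀+16)(1+h)ρ`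
  climbing vacancies (the climbing member of the pair carries them all; `forced_vacantSlots_cell`).
* `inPlane_upVacancies_ge_sine` — the three classes: `√6 · √(1 − ⟪A e₃, e₃⟫²) · πρ² − 3√2π(6R₀+16)(1+h)ρ`
  climbing in-plane vacancies on the balls of grain 1 (six-term form).
* `card_upInPlane_eq_six`, `upInPlane_vacancies_ge_sine` — the same count written per ball,
  `Σ_{x ∈ X ∩ grain 1} #{w ∈ fccSlots : w₂ = 0, x + A w ∉ X, x₂ < (x + A w)₂}`, the form the
  per-ball ledger of the rigid rung consumes.

WHAT THIS IS NOT: the per-ball ledger, the outer faces, the stub; rung F-C1 not moved.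
-/

noncomputable section

namespace Summit.Ventures.Crystal3D.Theorems

open Summit.Ventures.Crystal3D Finset Matrix
open Literature.MathematicalPhysics.StatisticalMechanics (barlowPos fccStacking constHagg
  triangularVec₁ triangularVec₂)
open scoped InnerProductSpace

/-- Height of a slot site: `(x + v)₂ = x₂ + ⟪v, e₃⟫`. -/
theorem apply_two_add_eq_inner (x v : EuclideanSpace ℝ (Fin 3)) :
    (x + v) 2 = x 2 + ⟪v, EuclideanSpace.single (2 : Fin 3) (1 : ℝ)⟫_ℝ := by
  rw [PiLp.add_apply, apply_two_eq_inner_e₃ v]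

/-- **One in-plane class, climbing vacancies only.**  Under the hypotheses of
`forced_vacantSlots_cell_abs`:
`√2 |α| π ρ² − √2 π (6R₀+16)(1+h) ρ ≤ #{x : x + A W ∉ X, x₂ < (x + A W)₂} + #{x : x − A W ∉ X, x₂ < (x − A W)₂}`
(`α = ⟪A W, e₃⟫`; for `α > 0` every `+A W` vacancy climbs and no `−A W` vacancy does, for `α < 0`
the other way round, for `α = 0` the left side is non-positive). -/
theorem forced_upSlots_cell_abs
    (A : EuclideanSpace ℝ (Fin 3) ≃ₗᵢ[ℝ] EuclideanSpace ℝ (Fin 3)) (t : EuclideanSpace ℝ (Fin 3))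
    [DecidablePred fun p : EuclideanSpace ℝ (Fin 3) =>
      p ∈ (fun q => A q + t) '' fccStacking 1 (Real.sqrt (2 / 3))]
    (A₂ : EuclideanSpace ℝ (Fin 3) ≃ₗᵢ[ℝ] EuclideanSpace ℝ (Fin 3)) (t₂ : EuclideanSpace ℝ (Fin 3))
    (X : Finset (EuclideanSpace ℝ (Fin 3)))
    (hX : ∀ p ∈ X, ∀ q ∈ X, p ≠ q → 1 ≤ dist p q)
    (R₀ h ρ : ℝ) (hR₀ : 3 ≤ R₀) (hh : 0 ≤ h) (hρ : R₀ ≤ ρ)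
    (hP₁ : ∀ p ∈ (fun q => A q + t) '' fccStacking 1 (Real.sqrt (2 / 3)),
      -(2 * R₀) ≤ p 2 → p 2 ≤ -R₀ → p 0 ^ 2 + p 1 ^ 2 ≤ ρ ^ 2 → p ∈ X)
    (hP₂ : ∀ p ∈ (fun q => A₂ q + t₂) '' fccStacking 1 (Real.sqrt (2 / 3)),
      h + R₀ ≤ p 2 → p 2 ≤ h + 2 * R₀ → p 0 ^ 2 + p 1 ^ 2 ≤ ρ ^ 2 → p ∈ X)
    (hdisj : ∀ p ∈ (fun q => A q + t) '' fccStacking 1 (Real.sqrt (2 / 3)),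
      p ∉ (fun q => A₂ q + t₂) '' fccStacking 1 (Real.sqrt (2 / 3)))
    (Ea Eb W : EuclideanSpace ℝ (Fin 3)) (hEa : ‖Ea‖ ≤ 1) (hEb : ‖Eb‖ ≤ 1) (hW : ‖W‖ = 1)
    (hdet : (Matrix.det ![WithLp.ofLp Ea, WithLp.ofLp Eb, WithLp.ofLp W]) ^ 2 = 1 / 2)
    (hframe : ∀ a b τ : ℤ,
      (a : ℝ) • Ea + (b : ℝ) • Eb + (τ : ℝ) • W ∈ fccStacking 1 (Real.sqrt (2 / 3)))
    (hspan : ∀ q ∈ fccStacking 1 (Real.sqrt (2 / 3)), ∃ a b τ : ℤ,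
      q = (a : ℝ) • Ea + (b : ℝ) • Eb + (τ : ℝ) • W) :
    Real.sqrt 2 * |⟪A W, EuclideanSpace.single (2 : Fin 3) (1 : ℝ)⟫_ℝ| * Real.pi * ρ ^ 2 -
        Real.sqrt 2 * Real.pi * (6 * R₀ + 16) * (1 + h) * ρ ≤
      (((X.filter fun p => p ∈ (fun q => A q + t) '' fccStacking 1 (Real.sqrt (2 / 3))).filter
          fun p => p + A W ∉ X ∧ p 2 < (p + A W) 2).card : ℝ) +
      (((X.filter fun p => p ∈ (fun q => A q + t) '' fccStacking 1 (Real.sqrt (2 / 3))).filter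
          fun p => p - A W ∉ X ∧ p 2 < (p - A W) 2).card : ℝ) := by
  set α : ℝ := ⟪A W, EuclideanSpace.single (2 : Fin 3) (1 : ℝ)⟫_ℝ with hα
  set X₁ := X.filter fun p => p ∈ (fun q => A q + t) '' fccStacking 1 (Real.sqrt (2 / 3)) with hX₁
  have hρ0 : 0 ≤ ρ := by linarith
  have hC0 : 0 ≤ Real.sqrt 2 * Real.pi * (6 * R₀ + 16) * (1 + h) * ρ := by
    have : 0 ≤ 6 * R₀ + 16 := by linarith
    positivity
  have hc1 : (0 : ℝ) ≤ ((X₁.filter fun p => p + A W ∉ X ∧ p 2 < (p + A W) 2).card : ℝ) :=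
    Nat.cast_nonneg _
  have hc2 : (0 : ℝ) ≤ ((X₁.filter fun p => p - A W ∉ X ∧ p 2 < (p - A W) 2).card : ℝ) :=
    Nat.cast_nonneg _
  rcases lt_trichotomy 0 α with hpos | hzero | hneg
  · have key := forced_vacantSlots_cell A t A₂ t₂ X hX R₀ h ρ hR₀ hh hρ hP₁ hP₂ hdisj Ea Eb W hEa hEb
      hW hdet hframe hspan hpos
    -- every `+A W` vacancy climbs
    have e : (X₁.filter fun p => p + A W ∉ X ∧ p 2 < (p + A W) 2) =
        (X₁.filter fun p => p + A W ∉ X) := by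
      refine filter_congr fun p _ => ⟨fun hp => hp.1, fun hp => ⟨hp, ?_⟩⟩
      rw [apply_two_add_eq_inner]; linarith
    rw [e, abs_of_pos hpos]
    linarith
  · rw [← hzero, abs_zero, mul_zero, zero_mul, zero_mul, zero_sub]
    linarith
  · -- use the frame `(Ea, Eb, −W)`: every `−A W` vacancy climbs
    have hW' : ‖-W‖ = 1 := by rw [norm_neg, hW]
    have hdet' := (det_sq_neg_third Ea Eb W).trans hdet
    have hframe' : ∀ a b τ : ℤ,
        (a : ℝ) • Ea + (b : ℝ) • Eb + (τ : ℝ) • (-W) ∈ fccStacking 1 (Real.sqrt (2 / 3)) := by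
      intro a b τ
      have := hframe a b (-τ)
      rw [Int.cast_neg, neg_smul] at this
      rwa [smul_neg]
    have hspan' : ∀ q ∈ fccStacking 1 (Real.sqrt (2 / 3)), ∃ a b τ : ℤ,
        q = (a : ℝ) • Ea + (b : ℝ) • Eb + (τ : ℝ) • (-W) := by
      intro q hq
      obtain ⟨a, b, τ, rfl⟩ := hspan q hq
      refine ⟨a, b, -τ, ?_⟩
      rw [Int.cast_neg, neg_smul, smul_neg, neg_neg]
    have hpos' : 0 < ⟪A (-W), EuclideanSpace.single (2 : Fin 3) (1 : ℝ)⟫_ℝ := by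
      rw [map_neg, inner_neg_left]; linarith
    have key := forced_vacantSlots_cell A t A₂ t₂ X hX R₀ h ρ hR₀ hh hρ hP₁ hP₂ hdisj Ea Eb (-W)
      hEa hEb hW' hdet' hframe' hspan' hpos'
    have hin : ⟪A (-W), EuclideanSpace.single (2 : Fin 3) (1 : ℝ)⟫_ℝ = -α := by
      rw [map_neg, inner_neg_left]
    rw [hin] at key
    have e : (X₁.filter fun p => p - A W ∉ X ∧ p 2 < (p - A W) 2) =
        (X₁.filter fun p => p + A (-W) ∉ X) := by
      refine filter_congr fun p _ => ?_
      have hsub : p - A W = p + A (-W) := by rw [map_neg, sub_eq_add_neg]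
      rw [hsub]
      refine ⟨fun hp => hp.1, fun hp => ⟨hp, ?_⟩⟩
      rw [apply_two_add_eq_inner]; linarith
    rw [e, abs_of_neg hneg]
    linarith

/-- **The riser count, climbing vacancies only.**  The six directed in-plane slots of grain 1
carry at least `√6 · √(1 − ⟪A e₃, e₃⟫²) · π ρ² − 3√2 π (6R₀ + 16)(1 + h) ρ` CLIMBING vacancies. -/
theorem inPlane_upVacancies_ge_sine
    (A : EuclideanSpace ℝ (Fin 3) ≃ₗᵢ[ℝ] EuclideanSpace ℝ (Fin 3)) (t : EuclideanSpace ℝ (Fin 3))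
    [DecidablePred fun p : EuclideanSpace ℝ (Fin 3) =>
      p ∈ (fun q => A q + t) '' fccStacking 1 (Real.sqrt (2 / 3))]
    (A₂ : EuclideanSpace ℝ (Fin 3) ≃ₗᵢ[ℝ] EuclideanSpace ℝ (Fin 3)) (t₂ : EuclideanSpace ℝ (Fin 3))
    (X : Finset (EuclideanSpace ℝ (Fin 3)))
    (hX : ∀ p ∈ X, ∀ q ∈ X, p ≠ q → 1 ≤ dist p q)
    (R₀ h ρ : ℝ) (hR₀ : 3 ≤ R₀) (hh : 0 ≤ h) (hρ : R₀ ≤ ρ)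
    (hP₁ : ∀ p ∈ (fun q => A q + t) '' fccStacking 1 (Real.sqrt (2 / 3)),
      -(2 * R₀) ≤ p 2 → p 2 ≤ -R₀ → p 0 ^ 2 + p 1 ^ 2 ≤ ρ ^ 2 → p ∈ X)
    (hP₂ : ∀ p ∈ (fun q => A₂ q + t₂) '' fccStacking 1 (Real.sqrt (2 / 3)),
      h + R₀ ≤ p 2 → p 2 ≤ h + 2 * R₀ → p 0 ^ 2 + p 1 ^ 2 ≤ ρ ^ 2 → p ∈ X)
    (hdisj : ∀ p ∈ (fun q => A q + t) '' fccStacking 1 (Real.sqrt (2 / 3)),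
      p ∉ (fun q => A₂ q + t₂) '' fccStacking 1 (Real.sqrt (2 / 3))) :
    Real.sqrt 6 * Real.sqrt (1 - ⟪A (EuclideanSpace.single (2 : Fin 3) (1 : ℝ)),
        EuclideanSpace.single (2 : Fin 3) (1 : ℝ)⟫_ℝ ^ 2) * Real.pi * ρ ^ 2 -
        3 * (Real.sqrt 2 * Real.pi * (6 * R₀ + 16) * (1 + h) * ρ) ≤
      (((X.filter fun p => p ∈ (fun q => A q + t) '' fccStacking 1 (Real.sqrt (2 / 3))).filter
          fun p => p + A (triangularVec₁ 1) ∉ X ∧ p 2 < (p + A (triangularVec₁ 1)) 2).card : ℝ) +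
      (((X.filter fun p => p ∈ (fun q => A q + t) '' fccStacking 1 (Real.sqrt (2 / 3))).filter
          fun p => p - A (triangularVec₁ 1) ∉ X ∧ p 2 < (p - A (triangularVec₁ 1)) 2).card : ℝ) +
      (((X.filter fun p => p ∈ (fun q => A q + t) '' fccStacking 1 (Real.sqrt (2 / 3))).filter
          fun p => p + A (triangularVec₂ 1) ∉ X ∧ p 2 < (p + A (triangularVec₂ 1)) 2).card : ℝ) +
      (((X.filter fun p => p ∈ (fun q => A q + t) '' fccStacking 1 (Real.sqrt (2 / 3))).filter
          fun p => p - A (triangularVec₂ 1) ∉ X ∧ p 2 < (p - A (triangularVec₂ 1)) 2).card : ℝ) +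
      (((X.filter fun p => p ∈ (fun q => A q + t) '' fccStacking 1 (Real.sqrt (2 / 3))).filter
          fun p => p + A (triangularVec₂ 1 - triangularVec₁ 1) ∉ X ∧
            p 2 < (p + A (triangularVec₂ 1 - triangularVec₁ 1)) 2).card : ℝ) +
      (((X.filter fun p => p ∈ (fun q => A q + t) '' fccStacking 1 (Real.sqrt (2 / 3))).filter
          fun p => p - A (triangularVec₂ 1 - triangularVec₁ 1) ∉ X ∧
            p 2 < (p - A (triangularVec₂ 1 - triangularVec₁ 1)) 2).card : ℝ) := by
  obtain ⟨hu_eq, hv_eq⟩ := inPlane_generators_eq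
  -- class `u`
  obtain ⟨h1, h2, h3, h4, h5, h6⟩ := inPlaneFrame_u
  have cu := forced_upSlots_cell_abs A t A₂ t₂ X hX R₀ h ρ hR₀ hh hρ hP₁ hP₂ hdisj _ _ _
    h1 h2 h3 h4 h5 h6
  rw [hu_eq] at cu
  -- class `v`
  obtain ⟨h1, h2, h3, h4, h5, h6⟩ := inPlaneFrame_v
  have cv := forced_upSlots_cell_abs A t A₂ t₂ X hX R₀ h ρ hR₀ hh hρ hP₁ hP₂ hdisj _ _ _
    h1 h2 h3 h4 h5 h6
  rw [hv_eq] at cv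
  -- class `u − v`
  obtain ⟨h1, h2, h3, h4, h5, h6⟩ := inPlaneFrame_uv
  have cuv := forced_upSlots_cell_abs A t A₂ t₂ X hX R₀ h ρ hR₀ hh hρ hP₁ hP₂ hdisj _ _ _
    h1 h2 h3 h4 h5 h6
  have huv : barlowPos 1 (Real.sqrt (2 / 3)) constHagg 0 1 (-1) = triangularVec₁ 1 - triangularVec₂ 1 := by
    rw [← hu_eq, ← hv_eq, ← fcc_bond_differences.1]
  rw [huv] at cuv
  -- `u − v = −(v − u)`: swap the two directed counts and the sign inside `|·|`
  have e1 : A (triangularVec₁ 1 - triangularVec₂ 1) = -A (triangularVec₂ 1 - triangularVec₁ 1) := by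
    rw [← map_neg, neg_sub]
  rw [e1, inner_neg_left, abs_neg] at cuv
  have e2 : ((X.filter fun p => p ∈ (fun q => A q + t) '' fccStacking 1 (Real.sqrt (2 / 3))).filter
      fun p => p + -A (triangularVec₂ 1 - triangularVec₁ 1) ∉ X ∧
        p 2 < (p + -A (triangularVec₂ 1 - triangularVec₁ 1)) 2) =
      ((X.filter fun p => p ∈ (fun q => A q + t) '' fccStacking 1 (Real.sqrt (2 / 3))).filter
      fun p => p - A (triangularVec₂ 1 - triangularVec₁ 1) ∉ X ∧
        p 2 < (p - A (triangularVec₂ 1 - triangularVec₁ 1)) 2) := by simp only [sub_eq_add_neg]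
  have e3 : ((X.filter fun p => p ∈ (fun q => A q + t) '' fccStacking 1 (Real.sqrt (2 / 3))).filter
      fun p => p - -A (triangularVec₂ 1 - triangularVec₁ 1) ∉ X ∧
        p 2 < (p - -A (triangularVec₂ 1 - triangularVec₁ 1)) 2) =
      ((X.filter fun p => p ∈ (fun q => A q + t) '' fccStacking 1 (Real.sqrt (2 / 3))).filter
      fun p => p + A (triangularVec₂ 1 - triangularVec₁ 1) ∉ X ∧
        p 2 < (p + A (triangularVec₂ 1 - triangularVec₁ 1)) 2) := by simp only [sub_neg_eq_add]
  rw [e2, e3] at cuv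
  -- the tilt inequality
  have htilt := coaxial_sine_le_inPlaneClasses A
  have hπρ : 0 ≤ Real.pi * ρ ^ 2 := by positivity
  have hmul := mul_le_mul_of_nonneg_right htilt hπρ
  nlinarith [cu, cv, cuv, hmul]

/-- **Per-ball form of the climbing in-plane vacancy count.**  For a host site `x` with slots
`x + A w`, the number of horizontal model slots `w` (`w₂ = 0`) whose site is vacant and climbs is
the sum of the six indicators of `inPlane_upVacancies_ge_sine`. -/
theorem card_upInPlane_eq_six (A : EuclideanSpace ℝ (Fin 3) ≃ₗᵢ[ℝ] EuclideanSpace ℝ (Fin 3))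
    (X : Finset (EuclideanSpace ℝ (Fin 3))) (x : EuclideanSpace ℝ (Fin 3)) :
    ((fccSlots.filter fun w => w 2 = 0 ∧ (x + A w ∉ X ∧ x 2 < (x + A w) 2)).card : ℕ) =
      (if x + A (triangularVec₁ 1) ∉ X ∧ x 2 < (x + A (triangularVec₁ 1)) 2 then 1 else 0) +
      (if x - A (triangularVec₁ 1) ∉ X ∧ x 2 < (x - A (triangularVec₁ 1)) 2 then 1 else 0) +
      (if x + A (triangularVec₂ 1) ∉ X ∧ x 2 < (x + A (triangularVec₂ 1)) 2 then 1 else 0) +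
      (if x - A (triangularVec₂ 1) ∉ X ∧ x 2 < (x - A (triangularVec₂ 1)) 2 then 1 else 0) +
      (if x + A (triangularVec₂ 1 - triangularVec₁ 1) ∉ X ∧
          x 2 < (x + A (triangularVec₂ 1 - triangularVec₁ 1)) 2 then 1 else 0) +
      (if x - A (triangularVec₂ 1 - triangularVec₁ 1) ∉ X ∧
          x 2 < (x - A (triangularVec₂ 1 - triangularVec₁ 1)) 2 then 1 else 0) := by
  classical
  rw [card_filter_fccSlots_horizontal (fun w => x + A w ∉ X ∧ x 2 < (x + A w) 2)]
  simp only [map_neg, ← sub_eq_add_neg]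

/-- **The riser count, per-ball form.**  Under the hypotheses of `inPlane_upVacancies_ge_sine`:
`√6 · √(1 − ⟪A e₃, e₃⟫²) · πρ² − 3√2π(6R₀+16)(1+h)ρ ≤ Σ_{x ∈ X ∩ grain 1} #{w ∈ fccSlots : w₂ = 0, x + A w ∉ X, x₂ < (x + A w)₂}`. -/
theorem upInPlane_vacancies_ge_sine
    (A : EuclideanSpace ℝ (Fin 3) ≃ₗᵢ[ℝ] EuclideanSpace ℝ (Fin 3)) (t : EuclideanSpace ℝ (Fin 3))
    [DecidablePred fun p : EuclideanSpace ℝ (Fin 3) =>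
      p ∈ (fun q => A q + t) '' fccStacking 1 (Real.sqrt (2 / 3))]
    (A₂ : EuclideanSpace ℝ (Fin 3) ≃ₗᵢ[ℝ] EuclideanSpace ℝ (Fin 3)) (t₂ : EuclideanSpace ℝ (Fin 3))
    (X : Finset (EuclideanSpace ℝ (Fin 3)))
    (hX : ∀ p ∈ X, ∀ q ∈ X, p ≠ q → 1 ≤ dist p q)
    (R₀ h ρ : ℝ) (hR₀ : 3 ≤ R₀) (hh : 0 ≤ h) (hρ : R₀ ≤ ρ)
    (hP₁ : ∀ p ∈ (fun q => A q + t) '' fccStacking 1 (Real.sqrt (2 / 3)),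
      -(2 * R₀) ≤ p 2 → p 2 ≤ -R₀ → p 0 ^ 2 + p 1 ^ 2 ≤ ρ ^ 2 → p ∈ X)
    (hP₂ : ∀ p ∈ (fun q => A₂ q + t₂) '' fccStacking 1 (Real.sqrt (2 / 3)),
      h + R₀ ≤ p 2 → p 2 ≤ h + 2 * R₀ → p 0 ^ 2 + p 1 ^ 2 ≤ ρ ^ 2 → p ∈ X)
    (hdisj : ∀ p ∈ (fun q => A q + t) '' fccStacking 1 (Real.sqrt (2 / 3)),
      p ∉ (fun q => A₂ q + t₂) '' fccStacking 1 (Real.sqrt (2 / 3))) :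
    Real.sqrt 6 * Real.sqrt (1 - ⟪A (EuclideanSpace.single (2 : Fin 3) (1 : ℝ)),
        EuclideanSpace.single (2 : Fin 3) (1 : ℝ)⟫_ℝ ^ 2) * Real.pi * ρ ^ 2 -
        3 * (Real.sqrt 2 * Real.pi * (6 * R₀ + 16) * (1 + h) * ρ) ≤
      ∑ x ∈ X.filter (fun p => p ∈ (fun q => A q + t) '' fccStacking 1 (Real.sqrt (2 / 3))),
        (((fccSlots.filter fun w => w 2 = 0 ∧ (x + A w ∉ X ∧ x 2 < (x + A w) 2)).card : ℕ) : ℝ) := by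
  classical
  have key := inPlane_upVacancies_ge_sine A t A₂ t₂ X hX R₀ h ρ hR₀ hh hρ hP₁ hP₂ hdisj
  set X₁ := X.filter fun p => p ∈ (fun q => A q + t) '' fccStacking 1 (Real.sqrt (2 / 3)) with hX₁
  have hsum : ∑ x ∈ X₁, (((fccSlots.filter fun w => w 2 = 0 ∧ (x + A w ∉ X ∧ x 2 < (x + A w) 2)).card : ℕ) : ℝ) =
      ((X₁.filter fun p => p + A (triangularVec₁ 1) ∉ X ∧ p 2 < (p + A (triangularVec₁ 1)) 2).card : ℝ) +
      ((X₁.filter fun p => p - A (triangularVec₁ 1) ∉ X ∧ p 2 < (p - A (triangularVec₁ 1)) 2).card : ℝ) +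
      ((X₁.filter fun p => p + A (triangularVec₂ 1) ∉ X ∧ p 2 < (p + A (triangularVec₂ 1)) 2).card : ℝ) +
      ((X₁.filter fun p => p - A (triangularVec₂ 1) ∉ X ∧ p 2 < (p - A (triangularVec₂ 1)) 2).card : ℝ) +
      ((X₁.filter fun p => p + A (triangularVec₂ 1 - triangularVec₁ 1) ∉ X ∧
          p 2 < (p + A (triangularVec₂ 1 - triangularVec₁ 1)) 2).card : ℝ) +
      ((X₁.filter fun p => p - A (triangularVec₂ 1 - triangularVec₁ 1) ∉ X ∧
          p 2 < (p - A (triangularVec₂ 1 - triangularVec₁ 1)) 2).card : ℝ) := by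
    have h1 : ∑ x ∈ X₁, ((fccSlots.filter fun w => w 2 = 0 ∧ (x + A w ∉ X ∧ x 2 < (x + A w) 2)).card : ℕ) =
        (X₁.filter fun p => p + A (triangularVec₁ 1) ∉ X ∧ p 2 < (p + A (triangularVec₁ 1)) 2).card +
        (X₁.filter fun p => p - A (triangularVec₁ 1) ∉ X ∧ p 2 < (p - A (triangularVec₁ 1)) 2).card +
        (X₁.filter fun p => p + A (triangularVec₂ 1) ∉ X ∧ p 2 < (p + A (triangularVec₂ 1)) 2).card +
        (X₁.filter fun p => p - A (triangularVec₂ 1) ∉ X ∧ p 2 < (p - A (triangularVec₂ 1)) 2).card +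
        (X₁.filter fun p => p + A (triangularVec₂ 1 - triangularVec₁ 1) ∉ X ∧
            p 2 < (p + A (triangularVec₂ 1 - triangularVec₁ 1)) 2).card +
        (X₁.filter fun p => p - A (triangularVec₂ 1 - triangularVec₁ 1) ∉ X ∧
            p 2 < (p - A (triangularVec₂ 1 - triangularVec₁ 1)) 2).card := by
      rw [Finset.sum_congr rfl (fun x _ => card_upInPlane_eq_six A X x)]
      simp only [sum_add_distrib, ← card_filter]
    exact_mod_cast congrArg (Nat.cast : ℕ → ℝ) h1
  rw [hsum]
  exact key

end Summit.Ventures.Crystal3D.Theorems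

end
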